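import Summits.Ventures.PercRepro2.CaseOneResidual

/-!
# Moves: thickenings and the pendant step in one relation
(blind cell PercRepro2, p1 g22; the thickening relation extended by the step that MOVES the statement
vertex onto a new leaf — the pendant lemma K8 and its Q-side)

`MoveStep o a₁ a₂ b E' ends' v' E ends v` relates a graph with its statement vertex to a graph with
(possibly another) statement vertex: either a thickening step with the statement vertex fixed
(`MoveStep.thick`, the four transfers of `ThickStep`), or the PENDANT STEP `MoveStep.leafMove`: a leaf
`a₃ ∉ {o, a₁, a₂, b}` hanging at `x` through `e₀`, the statement vertex moving from `x` (in `G − e₀`) to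
`a₃` (in `G`) — the four forms at `x` in `G − e₀` give them at `x` in `G` (`fourForms_of_restrict`) and
then at `a₃` by K8 and its Q-side (`zSplitII/IIQ/I/IQ_of_leaf_at`). `Moves` is the reflexive–transitive
closure. **`closedAt_of_moves`**: the closed property at `(E', ends', v')` gives it at every
`(E, ends, v)` reachable by moves — the pendant trees of `CaseOnePendantTree` (a path of pendant steps
to the statement vertex, the other branches as leaf thickenings), the series–parallel thickenings and the
loops, in one induction. Own code; standard axioms. -/

namespace Summit.Ventures.PercRepro2

namespace CaseOne

universe u

section Moves
variable {V : Type*}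

/-- **One move**: a thickening step with the statement vertex fixed, or the pendant step moving the
statement vertex from `x` to a new leaf `a₃ ∉ {o, a₁, a₂, b}` at `x`. -/
inductive MoveStep (o a₁ a₂ b : V) :
    (E' : Type u) → [Fintype E'] → [DecidableEq E'] → (E' → Sym2 V) → V →
      (E : Type u) → [Fintype E] → [DecidableEq E] → (E → Sym2 V) → V → Prop
  /-- a thickening step, the statement vertex fixed -/
  | thick {E' : Type u} [Fintype E'] [DecidableEq E'] {ends' : E' → Sym2 V} {v : V} {E : Type u}
      [Fintype E] [DecidableEq E] {ends : E → Sym2 V} (h : ThickStep o a₁ a₂ b v E' ends' E ends) :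
      MoveStep o a₁ a₂ b E' ends' v E ends v
  /-- the pendant step: the statement vertex moves from `x` to the leaf `a₃` at `x` -/
  | leafMove (E : Type u) [Fintype E] [DecidableEq E] (ends : E → Sym2 V) (x a₃ : V) (e₀ : E)
      (hl : IsLeafAt ends x a₃ e₀) (ho : o ≠ a₃) (h1 : a₁ ≠ a₃) (h2 : a₂ ≠ a₃) (hb : b ≠ a₃) :
      MoveStep o a₁ a₂ b {e : E // e ≠ e₀} (restrictEnds ends e₀) x E ends a₃

/-- **Moves**: finitely many `MoveStep`s (an inductive family, the edge type and the statement vertex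
changing along the way). -/
inductive Moves (o a₁ a₂ b : V) :
    (E' : Type u) → [Fintype E'] → [DecidableEq E'] → (E' → Sym2 V) → V →
      (E : Type u) → [Fintype E] → [DecidableEq E] → (E → Sym2 V) → V → Prop
  /-- no move -/
  | refl (E : Type u) [Fintype E] [DecidableEq E] (ends : E → Sym2 V) (v : V) :
      Moves o a₁ a₂ b E ends v E ends v
  /-- one more move -/
  | tail {E' : Type u} [Fintype E'] [DecidableEq E'] {ends' : E' → Sym2 V} {v' : V} {Em : Type u}
      [Fintype Em] [DecidableEq Em] {endsm : Em → Sym2 V} {vm : V} {E : Type u} [Fintype E]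
      [DecidableEq E] {ends : E → Sym2 V} {v : V} (h : Moves o a₁ a₂ b E' ends' v' Em endsm vm)
      (hstep : MoveStep o a₁ a₂ b Em endsm vm E ends v) : Moves o a₁ a₂ b E' ends' v' E ends v

variable {R : Type*} [CommRing R] [LinearOrder R] [IsStrictOrderedRing R] {o a₁ a₂ b : V}

/-- One move preserves the closed property (K8 and its Q-side for the pendant step). -/
theorem closedAt_of_moveStep {E' : Type u} [Fintype E'] [DecidableEq E'] {ends' : E' → Sym2 V} {v' : V}
    {E : Type u} [Fintype E] [DecidableEq E] {ends : E → Sym2 V} {v : V}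
    (h : MoveStep o a₁ a₂ b E' ends' v' E ends v) (hc : ClosedAt R o a₁ a₂ b E' ends' v') :
    ClosedAt R o a₁ a₂ b E ends v := by
  cases h with
  | thick h => exact closedAt_of_thickStep h hc
  | leafMove _ _ _ _ e₀ hl ho h1 h2 hb =>
    intro p hp
    -- the four forms at the attachment vertex in `G`, then K8 and its Q-side at the leaf
    have hx := fourForms_of_restrict p hl ho h1 h2 hl.ne hb (hc (restrictW p e₀) (IsProbVec.restrictW hp e₀))
    exact ⟨zSplitII_of_leaf_at p hp hl o a₁ a₂ b ho h1 h2 hb hx.1 hx.2.1,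
      zSplitIIQ_of_leaf_at p hp hl o a₁ a₂ b ho h1 h2 hb hx.2.1,
      zSplitI_of_leaf_at p hp hl o a₁ a₂ b ho h1 h2 hb hx.2.2.1 hx.2.2.2,
      zSplitIQ_of_leaf_at p hp hl o a₁ a₂ b ho h1 h2 hb hx.2.2.2⟩

/-- **The closed property is preserved by every sequence of moves.** -/
theorem closedAt_of_moves {E' : Type u} [Fintype E'] [DecidableEq E'] {ends' : E' → Sym2 V} {v' : V}
    {E : Type u} [Fintype E] [DecidableEq E] {ends : E → Sym2 V} {v : V}
    (h : Moves o a₁ a₂ b E' ends' v' E ends v) (hc : ClosedAt R o a₁ a₂ b E' ends' v') :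
    ClosedAt R o a₁ a₂ b E ends v := by
  induction h with
  | refl => exact hc
  | tail _ hstep ih => exact closedAt_of_moveStep hstep ih

/-- The four forms for one weight vector after any sequence of moves from a closed instance. -/
theorem fourForms_of_moves {E' : Type u} [Fintype E'] [DecidableEq E'] {ends' : E' → Sym2 V} {v' : V}
    {E : Type u} [Fintype E] [DecidableEq E] {ends : E → Sym2 V} {v : V}
    (h : Moves o a₁ a₂ b E' ends' v' E ends v) (hc : ClosedAt R o a₁ a₂ b E' ends' v') (p : E → R)
    (hp : IsProbVec p) : FourForms p ends o a₁ a₂ v b :=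
  closedAt_of_moves h hc p hp

end Moves

end CaseOne

end Summit.Ventures.PercRepro2
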